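import Literature.Topology.FourManifolds.HomotopySpheresStablyParallelizableStability
import Mathlib.LinearAlgebra.UnitaryGroup
import Mathlib.LinearAlgebra.Matrix.ConjTranspose
import Mathlib.Analysis.Complex.Basic
import Mathlib.LinearAlgebra.Matrix.Notation
import HarnessLib

/-!
# The double cover `SU(4) → SO(6)` (`Spin(6) ≅ SU(4)`): the homomorphism, its kernel and its image

Topic `Literature/Topology/FourManifolds`, sibling of `HomotopySpheresStablyParallelizable*.lean`,
towards the named fact `Literature.Topology.FourManifolds.Bott1959_sphereMapsToStableFramesExtend_six`
(`π₆(SO(8), 1) = 0`, Bott 1959), which the tree has reduced to `π₆(SO(6), 1) = 0`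
(`Bott1959_sphereMapsToStableFramesExtend_six_of_specialOrthogonalGroup_six`, `…Even.lean`). The
value `π₆(SO(6)) = 0` is `π₆(SU(4)) = π₆(U) = 0` (complex Bott periodicity) transported along the
exceptional isomorphism `Spin(6) ≅ SU(4)`, i.e. the two-sheeted covering homomorphism
`SU(4) → SO(6)` (É. Cartan; Porteous, *Clifford Algebras and the Classical Groups*, Prop. 17.3
"`Spin(6) ≅ SU(4)`", held copy PDF p. 119, and the variant proof at Diagram 24.5, PDF p. 200: an
explicit real-linear injection `ℂ³ → ℂ(4)` whose image is the vector space acted on, with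
"the determinant of the matrix representing `(z₀, z₁, z₂)` … `(z₀z̄₀ + z₁z̄₁ + z₂z̄₂)²`"; Hatcher,
*Algebraic Topology*, §3.D and Prop. 4.1: coverings induce isomorphisms on `πₙ`, `n ≥ 2`).
This file constructs that homomorphism by explicit matrices and proves everything about it that is
algebra (everything PROVED; no named facts; the covering and the transfer of `πₙ` are in the sibling
`…SpinSixCover.lean`):

* §1 over any commutative ring: antisymmetric `4 × 4` matrices `antisym y` (`y` the six upper
  entries), the Pfaffian `pf`, its polarisation `pfb`, the dual vector `dualVec`, and the identities
  `antisym y · antisym (dualVec y') + (y ↔ y') = -pfb y y' · 1` (the `4 × 4` analogue of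
  `M adj M = det M`), **`pf (A Y Aᵀ) = det A · pf Y`** and `det (antisym y) = (pf)²`, all by
  expansion (`ring`).
* §2 the real `6`-space `V ⊂ M₄(ℂ)`: `xMat v` for `v : Fin 6 → ℝ` (`a = v₀ + i v₁`, `b`, `c`;
  `xMat v = !![0, a, b, c; -a, 0, c̄, -b̄; -b, -c̄, 0, ā; -c, b̄, -ā, 0]`), with
  `(xMat v)ᴴ = -antisym (dualVec (xVec v))`, whence the **Clifford relations**
  `X(v) X(w)ᴴ + X(w) X(v)ᴴ = 2⟪v, w⟫ · 1 = X(v)ᴴ X(w) + X(w)ᴴ X(v)`, `pf (X v) = ⟪v, v⟫`,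
  `det (X v) = ⟪v, v⟫²`; coordinates `coord` with `coord (xMat v) = v`.
* §3 **invariance**: for `A ∈ SU(4)`, `A (X v) Aᵀ ∈ V` (it is antisymmetric, `Y Yᴴ = ⟪v,v⟫ · 1`
  by unitarity and `pf Y = ⟪v, v⟫` by `det A = 1`, and such a matrix lies in `V`:
  `xMat_coord_of_mul_conjTranspose`); the matrix **`toO6 A ∈ O(6)`** of `v ↦ X⁻¹(A X(v) Aᵀ)`,
  multiplicative, continuous, with `xMat (toO6 A *ᵥ v) = A * xMat v * Aᵀ`.
* §4 **kernel**: `toO6 A = 1` iff `A = ±1`.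
* §5 **image ⊇ SO(6)**: `xMat (ρᵤ x) = -X(u) X(x)ᴴ X(u)` for a unit `u` (`ρᵤ` the Householder
  reflection `SOTransport.reflMat u` of `…Stability.lean`), so `B(u, w) = X(u) X(w)ᴴ ∈ SU(4)` maps to
  `ρᵤ ρ_w`; and **`SO(N)` is generated by products of two reflections** (weak Cartan–Dieudonné,
  induction on `N` through the stabiliser `1 ⊕ SO(N - 1)` using `SOTransport.rotMat`,
  `SOTransport.eq_blockSucc_submatrix`), hence every element of `SO(6)` is `toO6 A` for some
  `A ∈ SU(4)`.

## References

* I. R. Porteous, *Clifford Algebras and the Classical Groups*, CUP (1995), Prop. 17.3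
  (`Spin(6) ≅ SU(4)`), Ch. 24, Diagram 24.5 (the explicit matrix model and its determinant).
  doi:10.1017/cbo9780511470912 [Porteous1995]
* D. Husemoller, *Fibre Bundles*, 3rd ed., GTM 20, Springer (1994), Ch. 14 (Clifford algebras and
  the groups `Spin(n)`). [HusemollerFibreBundles1994]
* A. Hatcher, *Algebraic Topology*, CUP (2002), §3.D (the coverings `S³ → SO(3)`, `S³ × S³ → SO(4)`),
  §4.1 Prop. 4.1. [HatcherAT2002]
* R. Bott, *The stable homotopy of the classical groups*, Ann. of Math. (2) 70 (1959), 313–337, §1 (1.5),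
  p. 315 (`π₆(O) = 0`; `π_k(U)`: `0, ℤ` periodic). doi:10.2307/1970106 [Bott1959]
-/

noncomputable section

namespace Literature.Topology.FourManifolds

namespace SpinSix

open Matrix Complex SOTransport
open scoped ComplexConjugate ComplexOrder

/-! ### 1. Antisymmetric `4 × 4` matrices over a commutative ring: Pfaffian identities -/

section CommRing

variable {R : Type*} [CommRing R]

/-- The antisymmetric `4 × 4` matrix with upper entries `y = (y₀₁, y₀₂, y₀₃, y₁₂, y₁₃, y₂₃)`. [folklore] -/
def antisym (y : Fin 6 → R) : Matrix (Fin 4) (Fin 4) R :=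
  !![0, y 0, y 1, y 2; -y 0, 0, y 3, y 4; -y 1, -y 3, 0, y 5; -y 2, -y 4, -y 5, 0]

/-- Entry of `antisym`. [folklore] -/
@[simp] theorem antisym_apply_01 (y : Fin 6 → R) : antisym y 0 1 = y 0 := rfl
/-- Entry of `antisym`. [folklore] -/
@[simp] theorem antisym_apply_02 (y : Fin 6 → R) : antisym y 0 2 = y 1 := rfl
/-- Entry of `antisym`. [folklore] -/
@[simp] theorem antisym_apply_03 (y : Fin 6 → R) : antisym y 0 3 = y 2 := rfl
/-- Entry of `antisym`. [folklore] -/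
@[simp] theorem antisym_apply_12 (y : Fin 6 → R) : antisym y 1 2 = y 3 := rfl
/-- Entry of `antisym`. [folklore] -/
@[simp] theorem antisym_apply_13 (y : Fin 6 → R) : antisym y 1 3 = y 4 := rfl
/-- Entry of `antisym`. [folklore] -/
@[simp] theorem antisym_apply_23 (y : Fin 6 → R) : antisym y 2 3 = y 5 := rfl

/-- `antisym y` is antisymmetric. [folklore] -/
theorem transpose_antisym (y : Fin 6 → R) : (antisym y)ᵀ = -antisym y := by
  ext i j; fin_cases i <;> fin_cases j <;> simp [antisym]

/-- `antisym` is additive. [folklore] -/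
theorem antisym_add (y y' : Fin 6 → R) : antisym (y + y') = antisym y + antisym y' := by
  ext i j; fin_cases i <;> fin_cases j <;> simp [antisym] <;> ring

/-- `antisym` is homogeneous. [folklore] -/
theorem antisym_smul (c : R) (y : Fin 6 → R) : antisym (c • y) = c • antisym y := by
  ext i j; fin_cases i <;> fin_cases j <;> simp [antisym]

/-- `antisym 0 = 0`. [folklore] -/
@[simp] theorem antisym_zero : antisym (0 : Fin 6 → R) = 0 := by
  ext i j; fin_cases i <;> fin_cases j <;> simp [antisym]

/-- `antisym` is additive over finite sums. [folklore] -/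
theorem antisym_sum {ι : Type*} (s : Finset ι) (y : ι → Fin 6 → R) :
    antisym (∑ k ∈ s, y k) = ∑ k ∈ s, antisym (y k) := by
  classical
  induction s using Finset.induction_on with
  | empty => simp
  | insert a s ha ih => rw [Finset.sum_insert ha, Finset.sum_insert ha, antisym_add, ih]

/-- `antisym` commutes with ring homomorphisms applied entrywise. [folklore] -/
theorem antisym_map {S : Type*} [CommRing S] (f : R →+* S) (y : Fin 6 → R) :
    (antisym y).map f = antisym (f ∘ y) := by
  ext i j; fin_cases i <;> fin_cases j <;> simp [antisym]

/-- **The Pfaffian** of a `4 × 4` matrix (read off its upper entries):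
`pf Y = Y₀₁ Y₂₃ - Y₀₂ Y₁₃ + Y₀₃ Y₁₂`. [folklore] -/
def pf (Y : Matrix (Fin 4) (Fin 4) R) : R := Y 0 1 * Y 2 3 - Y 0 2 * Y 1 3 + Y 0 3 * Y 1 2

/-- The polarised Pfaffian of two upper-entry vectors (`pfb y y = 2 pf (antisym y)`). [folklore] -/
def pfb (y y' : Fin 6 → R) : R :=
  y 0 * y' 5 + y' 0 * y 5 - (y 1 * y' 4 + y' 1 * y 4) + (y 2 * y' 3 + y' 2 * y 3)

/-- `pf (antisym y) = y₀ y₅ - y₁ y₄ + y₂ y₃`. [folklore] -/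
theorem pf_antisym (y : Fin 6 → R) : pf (antisym y) = y 0 * y 5 - y 1 * y 4 + y 2 * y 3 := rfl

/-- `pfb y y = 2 pf (antisym y)`. [folklore] -/
theorem pfb_self (y : Fin 6 → R) : pfb y y = 2 * pf (antisym y) := by
  simp only [pfb, pf_antisym]; ring

/-- `pfb` is symmetric. [folklore] -/
theorem pfb_comm (y y' : Fin 6 → R) : pfb y y' = pfb y' y := by
  simp only [pfb]; ring

/-- **The dual upper-entry vector** (`(dual Y)ᵢⱼ = ½ ∑ εᵢⱼₖₗ Yₖₗ`):
`(y₂₃, -y₁₃, y₁₂, y₀₃, -y₀₂, y₀₁)`. [folklore] -/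
def dualVec (y : Fin 6 → R) : Fin 6 → R := ![y 5, -y 4, y 3, y 2, -y 1, y 0]

/-- Duality is an involution. [folklore] -/
theorem dualVec_dualVec (y : Fin 6 → R) : dualVec (dualVec y) = y := by
  ext i; fin_cases i <;> simp [dualVec]

/-- **`Y · Y^D + Y' · Y'^D`-identity, polarised form of `Y Y^D = -pf(Y) 1`** (the `4 × 4`
antisymmetric analogue of `M adj M = det M · 1`). [folklore] -/
theorem antisym_mul_antisym_dualVec_add (y y' : Fin 6 → R) :
    antisym y * antisym (dualVec y') + antisym y' * antisym (dualVec y) =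
      -(pfb y y') • (1 : Matrix (Fin 4) (Fin 4) R) := by
  ext i j
  fin_cases i <;> fin_cases j <;> simp [antisym, dualVec, pfb] <;> ring

/-- The same identity with the dual factors on the left. [folklore] -/
theorem antisym_dualVec_mul_antisym_add (y y' : Fin 6 → R) :
    antisym (dualVec y) * antisym y' + antisym (dualVec y') * antisym y =
      -(pfb y y') • (1 : Matrix (Fin 4) (Fin 4) R) := by
  ext i j
  fin_cases i <;> fin_cases j <;> simp [antisym, dualVec, pfb] <;> ring

/-- `Y · Y^D = -pf(Y) · 1` for an antisymmetric `4 × 4` matrix `Y`. [folklore] -/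
theorem antisym_mul_antisym_dualVec (y : Fin 6 → R) :
    antisym y * antisym (dualVec y) = -(pf (antisym y)) • (1 : Matrix (Fin 4) (Fin 4) R) := by
  ext i j
  fin_cases i <;> fin_cases j <;>
    simp [antisym, dualVec, pf, Matrix.mul_apply, Fin.sum_univ_four] <;> ring

/-- `Y^D · Y = -pf(Y) · 1` for an antisymmetric `4 × 4` matrix `Y`. [folklore] -/
theorem antisym_dualVec_mul_antisym (y : Fin 6 → R) :
    antisym (dualVec y) * antisym y = -(pf (antisym y)) • (1 : Matrix (Fin 4) (Fin 4) R) := by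
  ext i j
  fin_cases i <;> fin_cases j <;>
    simp [antisym, dualVec, pf, Matrix.mul_apply, Fin.sum_univ_four] <;> ring

set_option maxHeartbeats 1000000 in
/-- **`pf (A Y Aᵀ) = det A · pf Y`** for antisymmetric `4 × 4` matrices `Y` (the defining
transformation property of the Pfaffian), by expansion of both sides. [folklore] -/
theorem pf_conj (A : Matrix (Fin 4) (Fin 4) R) (y : Fin 6 → R) :
    pf (A * antisym y * Aᵀ) = A.det * pf (antisym y) := by
  simp only [pf, antisym, Matrix.mul_apply, Matrix.transpose_apply,
    Matrix.det_succ_row_zero, Matrix.submatrix_apply, Fin.succAbove_zero,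
    Matrix.of_apply, Matrix.cons_val', Matrix.cons_val_zero, Matrix.cons_val_one,
    Matrix.empty_val', Matrix.cons_val_fin_one, Fin.sum_univ_succ, Fin.succ_zero_eq_one, Fin.succ_one_eq_two]
  simp [Fin.succAbove, Fin.lt_def]
  ring

set_option maxHeartbeats 1000000 in
/-- `det Y = pf(Y)²` for an antisymmetric `4 × 4` matrix `Y`, by expansion. [folklore] -/
theorem det_antisym (y : Fin 6 → R) : (antisym y).det = pf (antisym y) ^ 2 := by
  simp only [pf, antisym, Matrix.det_succ_row_zero, Matrix.submatrix_apply, Fin.succAbove_zero,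
    Matrix.of_apply, Matrix.cons_val', Matrix.cons_val_zero, Matrix.cons_val_one,
    Matrix.empty_val', Matrix.cons_val_fin_one, Fin.sum_univ_succ, Fin.succ_zero_eq_one, Fin.succ_one_eq_two]
  simp [Fin.succAbove, Fin.lt_def]
  ring

/-- The vector of upper entries of a `4 × 4` matrix. [folklore] -/
def upperVec (Y : Matrix (Fin 4) (Fin 4) R) : Fin 6 → R := ![Y 0 1, Y 0 2, Y 0 3, Y 1 2, Y 1 3, Y 2 3]

/-- `upperVec (antisym y) = y`. [folklore] -/
@[simp] theorem upperVec_antisym (y : Fin 6 → R) : upperVec (antisym y) = y := by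
  ext i; fin_cases i <;> simp [upperVec, antisym]

/-- An antisymmetric matrix is `antisym` of its upper entries (no `2`-torsion). [folklore] -/
theorem antisym_upperVec [NoZeroDivisors R] [CharZero R] {Y : Matrix (Fin 4) (Fin 4) R} (hY : Yᵀ = -Y) :
    antisym (upperVec Y) = Y := by
  have h : ∀ i j, Y j i = -Y i j := fun i j => by
    have := congrFun (congrFun hY i) j
    simpa using this
  have hd : ∀ i, Y i i = 0 := fun i => by
    have h2 : (2 : R) * Y i i = 0 := by
      rw [two_mul]; nth_rewrite 1 [h i i]; ring
    simpa using h2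
  have h10 := h 0 1; have h20 := h 0 2; have h30 := h 0 3
  have h21 := h 1 2; have h31 := h 1 3; have h32 := h 2 3
  ext i j; fin_cases i <;> fin_cases j <;> simp [upperVec, antisym, hd, h10, h20, h30, h21, h31, h32]

/-- Conjugation preserves antisymmetry: `(A Y Aᵀ)ᵀ = -(A Y Aᵀ)`. [folklore] -/
theorem transpose_conj_antisym (A : Matrix (Fin 4) (Fin 4) R) (y : Fin 6 → R) :
    (A * antisym y * Aᵀ)ᵀ = -(A * antisym y * Aᵀ) := by
  rw [Matrix.transpose_mul, Matrix.transpose_mul, Matrix.transpose_transpose, transpose_antisym]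
  simp [Matrix.mul_assoc]

end CommRing

/-! ### 2. The real `6`-space `V = {X(v)} ⊂ M₄(ℂ)` and the Clifford relations -/

section Cplx

/-- `a = v₀ + i v₁`. [folklore] -/
def za (v : Fin 6 → ℝ) : ℂ := (v 0 : ℂ) + (v 1 : ℂ) * I
/-- `b = v₂ + i v₃`. [folklore] -/
def zb (v : Fin 6 → ℝ) : ℂ := (v 2 : ℂ) + (v 3 : ℂ) * I
/-- `c = v₄ + i v₅`. [folklore] -/
def zc (v : Fin 6 → ℝ) : ℂ := (v 4 : ℂ) + (v 5 : ℂ) * I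

/-- The upper entries `(a, b, c, c̄, -b̄, ā)` of `X(v)`. [folklore] -/
def xVec (v : Fin 6 → ℝ) : Fin 6 → ℂ := ![za v, zb v, zc v, conj (zc v), -conj (zb v), conj (za v)]

/-- **The matrix `X(v) ∈ M₄(ℂ)` of `v ∈ ℝ⁶`**: with `a = v₀ + i v₁`, `b = v₂ + i v₃`, `c = v₄ + i v₅`,
`X(v) = !![0, a, b, c; -a, 0, c̄, -b̄; -b, -c̄, 0, ā; -c, b̄, -ā, 0]` — the standard identification of
`ℝ⁶` with the self-conjugate antisymmetric `2`-tensors of `ℂ⁴` on which `SU(4) = Spin(6)` acts by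
`X ↦ A X Aᵀ` (a variant of Porteous' injection `ℂ³ → ℂ(4)`, Diagram 24.5, with the same determinant
`(|a|² + |b|² + |c|²)²`, `det_xMat`). [cite: Porteous1995, Prop. 17.3 and Diagram 24.5] -/
def xMat (v : Fin 6 → ℝ) : Matrix (Fin 4) (Fin 4) ℂ := antisym (xVec v)

/-- `star (xVec v) = dualVec (xVec v)`: the conjugate of the entry vector is its dual. [folklore] -/
theorem star_xVec (v : Fin 6 → ℝ) : star (xVec v) = dualVec (xVec v) := by
  ext i; fin_cases i <;> simp [xVec, dualVec]

/-- `(antisym y)ᴴ = -antisym (star y)` over `ℂ`. [folklore] -/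
theorem conjTranspose_antisym (y : Fin 6 → ℂ) : (antisym y)ᴴ = -antisym (star y) := by
  ext i j; fin_cases i <;> fin_cases j <;> simp [antisym, Matrix.conjTranspose_apply]

/-- **`X(v)ᴴ = -X(v)^D`**: `(xMat v)ᴴ = -antisym (dualVec (xVec v))`. [folklore] -/
theorem conjTranspose_xMat (v : Fin 6 → ℝ) : (xMat v)ᴴ = -antisym (dualVec (xVec v)) := by
  rw [xMat, conjTranspose_antisym, star_xVec]

/-- `X(v)` is antisymmetric. [folklore] -/
theorem transpose_xMat (v : Fin 6 → ℝ) : (xMat v)ᵀ = -xMat v := transpose_antisym _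

/-- The polarised Pfaffian of two entry vectors is twice the Euclidean inner product. [folklore] -/
theorem pfb_xVec (v w : Fin 6 → ℝ) : pfb (xVec v) (xVec w) = ((2 * (v ⬝ᵥ w) : ℝ) : ℂ) := by
  simp [pfb, xVec, za, zb, zc, dotProduct, Fin.sum_univ_succ, Complex.ext_iff]
  constructor <;> ring

/-- **`pf X(v) = ⟪v, v⟫`** (`= |a|² + |b|² + |c|²`). [folklore] -/
theorem pf_xMat (v : Fin 6 → ℝ) : pf (xMat v) = ((v ⬝ᵥ v : ℝ) : ℂ) := by
  have h := pfb_self (xVec v)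
  rw [pfb_xVec] at h
  have h2 : ((2 * (v ⬝ᵥ v) : ℝ) : ℂ) = 2 * ((v ⬝ᵥ v : ℝ) : ℂ) := by push_cast; ring
  rw [h2] at h
  have := mul_left_cancel₀ (two_ne_zero' ℂ) h
  rw [xMat]; exact this.symm

/-- **`det X(v) = ⟪v, v⟫²`.** [folklore] -/
theorem det_xMat (v : Fin 6 → ℝ) : (xMat v).det = ((v ⬝ᵥ v : ℝ) : ℂ) ^ 2 := by
  rw [xMat, det_antisym, ← xMat, pf_xMat]

/-- **Clifford relation** `X(v) X(w)ᴴ + X(w) X(v)ᴴ = 2⟪v, w⟫ · 1`. [cite: Porteous1995, Prop. 17.3] -/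
theorem xMat_mul_conjTranspose_add (v w : Fin 6 → ℝ) :
    xMat v * (xMat w)ᴴ + xMat w * (xMat v)ᴴ = ((2 * (v ⬝ᵥ w) : ℝ) : ℂ) • (1 : Matrix (Fin 4) (Fin 4) ℂ) := by
  rw [conjTranspose_xMat, conjTranspose_xMat, Matrix.mul_neg, Matrix.mul_neg, ← neg_add, xMat, xMat,
    antisym_mul_antisym_dualVec_add, neg_smul, neg_neg, pfb_xVec]

/-- **Clifford relation** `X(v)ᴴ X(w) + X(w)ᴴ X(v) = 2⟪v, w⟫ · 1`. [cite: Porteous1995, Prop. 17.3] -/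
theorem conjTranspose_mul_xMat_add (v w : Fin 6 → ℝ) :
    (xMat v)ᴴ * xMat w + (xMat w)ᴴ * xMat v = ((2 * (v ⬝ᵥ w) : ℝ) : ℂ) • (1 : Matrix (Fin 4) (Fin 4) ℂ) := by
  rw [conjTranspose_xMat, conjTranspose_xMat, Matrix.neg_mul, Matrix.neg_mul, ← neg_add, xMat, xMat,
    antisym_dualVec_mul_antisym_add, neg_smul, neg_neg, pfb_xVec]

/-- `X(v) X(v)ᴴ = ⟪v, v⟫ · 1`. [folklore] -/
theorem xMat_mul_conjTranspose_self (v : Fin 6 → ℝ) :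
    xMat v * (xMat v)ᴴ = ((v ⬝ᵥ v : ℝ) : ℂ) • (1 : Matrix (Fin 4) (Fin 4) ℂ) := by
  rw [conjTranspose_xMat, Matrix.mul_neg, xMat, antisym_mul_antisym_dualVec, neg_smul, neg_neg, ← xMat, pf_xMat]

/-- `X(v)ᴴ X(v) = ⟪v, v⟫ · 1`. [folklore] -/
theorem conjTranspose_mul_xMat_self (v : Fin 6 → ℝ) :
    (xMat v)ᴴ * xMat v = ((v ⬝ᵥ v : ℝ) : ℂ) • (1 : Matrix (Fin 4) (Fin 4) ℂ) := by
  rw [conjTranspose_xMat, Matrix.neg_mul, xMat, antisym_dualVec_mul_antisym, neg_smul, neg_neg, ← xMat, pf_xMat]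

/-- For a unit vector `u`, `X(u)` is unitary. [folklore] -/
theorem xMat_mem_unitaryGroup {u : Fin 6 → ℝ} (hu : u ⬝ᵥ u = 1) : xMat u ∈ Matrix.unitaryGroup (Fin 4) ℂ := by
  rw [Matrix.mem_unitaryGroup_iff, star_eq_conjTranspose, xMat_mul_conjTranspose_self, hu]
  simp

/-- `xVec` is additive. [folklore] -/
theorem xVec_add (v w : Fin 6 → ℝ) : xVec (v + w) = xVec v + xVec w := by
  ext i; fin_cases i <;> simp [xVec, za, zb, zc] <;> ring

/-- `xVec` is real-homogeneous. [folklore] -/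
theorem xVec_smul (c : ℝ) (v : Fin 6 → ℝ) : xVec (c • v) = (c : ℂ) • xVec v := by
  ext i; fin_cases i <;> simp [xVec, za, zb, zc] <;> ring

/-- `X` is additive. [folklore] -/
theorem xMat_add (v w : Fin 6 → ℝ) : xMat (v + w) = xMat v + xMat w := by
  rw [xMat, xVec_add, antisym_add]; rfl

/-- `X` is real-homogeneous. [folklore] -/
theorem xMat_smul (c : ℝ) (v : Fin 6 → ℝ) : xMat (c • v) = (c : ℂ) • xMat v := by
  rw [xMat, xVec_smul, antisym_smul]; rfl

/-- `X(0) = 0`. [folklore] -/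
@[simp] theorem xMat_zero : xMat 0 = 0 := by
  have h := xMat_smul 0 0
  rwa [zero_smul, Complex.ofReal_zero, zero_smul] at h

/-- `X(-v) = -X(v)`. [folklore] -/
theorem xMat_neg (v : Fin 6 → ℝ) : xMat (-v) = -xMat v := by
  have h := xMat_smul (-1) v
  rwa [neg_one_smul, Complex.ofReal_neg, Complex.ofReal_one, neg_one_smul] at h

/-- `X(v - w) = X(v) - X(w)`. [folklore] -/
theorem xMat_sub (v w : Fin 6 → ℝ) : xMat (v - w) = xMat v - xMat w := by
  rw [sub_eq_add_neg, xMat_add, xMat_neg, sub_eq_add_neg]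

/-- `X` is additive over finite sums. [folklore] -/
theorem xMat_sum {ι : Type*} (s : Finset ι) (v : ι → Fin 6 → ℝ) :
    xMat (∑ k ∈ s, v k) = ∑ k ∈ s, xMat (v k) := by
  classical
  induction s using Finset.induction_on with
  | empty => simp
  | insert a s ha ih => rw [Finset.sum_insert ha, Finset.sum_insert ha, xMat_add, ih]

/-- `X(v)` as the combination `∑ vⱼ X(eⱼ)` of the six basis matrices. [folklore] -/
theorem xMat_eq_sum_single (v : Fin 6 → ℝ) :
    xMat v = ∑ j : Fin 6, (v j : ℂ) • xMat (Pi.single j 1) := by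
  conv_lhs => rw [show v = ∑ j : Fin 6, v j • (Pi.single j (1 : ℝ) : Fin 6 → ℝ) from by
    ext i; simp [Finset.sum_apply, Pi.single_apply]]
  rw [xMat_sum]
  simp only [xMat_smul]

/-- **Real coordinates on `V`**: the real and imaginary parts of the entries `Y₀₁, Y₀₂, Y₀₃`. [folklore] -/
def coord (Y : Matrix (Fin 4) (Fin 4) ℂ) : Fin 6 → ℝ :=
  ![(Y 0 1).re, (Y 0 1).im, (Y 0 2).re, (Y 0 2).im, (Y 0 3).re, (Y 0 3).im]

/-- `coord (X v) = v`. [folklore] -/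
@[simp] theorem coord_xMat (v : Fin 6 → ℝ) : coord (xMat v) = v := by
  ext i; fin_cases i <;> simp [coord, xMat, xVec, za, zb, zc]

/-- `coord` is additive. [folklore] -/
theorem coord_add (Y Z : Matrix (Fin 4) (Fin 4) ℂ) : coord (Y + Z) = coord Y + coord Z := by
  ext i; fin_cases i <;> simp [coord]

/-- `coord` is real-homogeneous. [folklore] -/
theorem coord_smul (c : ℝ) (Y : Matrix (Fin 4) (Fin 4) ℂ) : coord ((c : ℂ) • Y) = c • coord Y := by
  ext i; fin_cases i <;> simp [coord]

/-- `coord` is additive over finite sums. [folklore] -/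
theorem coord_sum {ι : Type*} (s : Finset ι) (Y : ι → Matrix (Fin 4) (Fin 4) ℂ) :
    coord (∑ k ∈ s, Y k) = ∑ k ∈ s, coord (Y k) := by
  classical
  induction s using Finset.induction_on with
  | empty => ext i; fin_cases i <;> simp [coord]
  | insert a s ha ih => rw [Finset.sum_insert ha, Finset.sum_insert ha, coord_add, ih]

/-- **Recognition of `V`**: an antisymmetric `Y ∈ M₄(ℂ)` with `Y Yᴴ = r · 1` and `pf Y = r` for a
real `r` lies in `V`, i.e. `X(coord Y) = Y` (for `r ≠ 0`: `Y Y^D = -r = -Y Yᴴ` and `Y` is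
invertible, so `Y^D = -Yᴴ`, which says `Y₂₃ = Ȳ₀₁`, `Y₁₃ = -Ȳ₀₂`, `Y₁₂ = Ȳ₀₃`; for `r = 0`,
`Y = 0`). [folklore] -/
theorem xMat_coord_of_mul_conjTranspose {Y : Matrix (Fin 4) (Fin 4) ℂ} {r : ℝ} (hY : Yᵀ = -Y)
    (hYY : Y * Yᴴ = (r : ℂ) • (1 : Matrix (Fin 4) (Fin 4) ℂ)) (hpf : pf Y = r) : xMat (coord Y) = Y := by
  -- write `Y = antisym y`
  set y := upperVec Y with hy
  have hYa : antisym y = Y := antisym_upperVec hY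
  rcases eq_or_ne r 0 with hr | hr
  · -- `Y Yᴴ = 0` forces `Y = 0`
    rw [hr, Complex.ofReal_zero, zero_smul] at hYY
    have hY0 : Y = 0 := Matrix.self_mul_conjTranspose_eq_zero.1 hYY
    rw [hY0]
    have : coord (0 : Matrix (Fin 4) (Fin 4) ℂ) = 0 := by ext i; fin_cases i <;> simp [coord]
    rw [this, xMat_zero]
  · -- `Y^D = -Yᴴ`
    have h1 : Y * antisym (dualVec y) = -(r : ℂ) • (1 : Matrix (Fin 4) (Fin 4) ℂ) := by
      conv_lhs => rw [← hYa]
      rw [antisym_mul_antisym_dualVec, hYa, hpf]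
    have h2 : Y * (antisym (dualVec y) + Yᴴ) = 0 := by
      rw [Matrix.mul_add, h1, hYY, neg_smul, neg_add_cancel]
    have hinv : ((r : ℂ)⁻¹ • Yᴴ) * Y = 1 := by
      have h3 : Y * ((r : ℂ)⁻¹ • Yᴴ) = 1 := by
        rw [Matrix.mul_smul, hYY, smul_smul, inv_mul_cancel₀ (Complex.ofReal_ne_zero.2 hr), one_smul]
      exact mul_eq_one_comm.1 h3
    have h4 : antisym (dualVec y) + Yᴴ = 0 := by
      have := congrArg (fun M => ((r : ℂ)⁻¹ • Yᴴ) * M) h2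
      simpa only [← Matrix.mul_assoc, hinv, Matrix.one_mul, Matrix.mul_zero] using this
    have h5 : antisym (dualVec y) = antisym (star y) := by
      rw [eq_neg_of_add_eq_zero_left h4, ← hYa, conjTranspose_antisym, neg_neg]
    have h6 : dualVec y = star y := by
      have := congrArg upperVec h5
      rwa [upperVec_antisym, upperVec_antisym] at this
    have e3 : y 3 = conj (y 2) := by
      have := congrFun h6 3; simp [dualVec] at this
      rw [this, Complex.conj_conj]
    have e4 : y 4 = -conj (y 1) := by
      have := congrFun h6 4; simp [dualVec] at this
      have h' : conj (y 4) = -y 1 := by rw [← this]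
      have := congrArg conj h'
      simpa using this
    have e5 : y 5 = conj (y 0) := by
      have := congrFun h6 5; simp [dualVec] at this
      rw [this, Complex.conj_conj]
    -- conclude
    rw [← hYa]
    have hc : coord (antisym y) = ![(y 0).re, (y 0).im, (y 1).re, (y 1).im, (y 2).re, (y 2).im] := by
      ext i; fin_cases i <;> simp [coord, antisym]
    rw [hc, xMat]
    congr 1
    ext i; fin_cases i <;> simp [xVec, za, zb, zc, e3, e4, e5, Complex.re_add_im]

end Cplx

/-! ### 3. The action `X ↦ A X Aᵀ` of `SU(4)` on `V` and the homomorphism `toO6 : SU(4) → O(6)` -/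

section Action

/-- For a unitary `A`, `Aᵀ` is unitary: `Aᵀ (Aᵀ)ᴴ = 1`. [folklore] -/
theorem transpose_mul_conjTranspose_transpose {A : Matrix (Fin 4) (Fin 4) ℂ}
    (hA : A ∈ Matrix.unitaryGroup (Fin 4) ℂ) : Aᵀ * (Aᵀ)ᴴ = 1 := by
  have h1 : (Aᵀ)ᴴ = (Aᴴ)ᵀ := by ext i j; simp
  have h2 : Aᴴ * A = 1 := by
    have := Matrix.mem_unitaryGroup_iff'.1 hA
    rwa [star_eq_conjTranspose] at this
  rw [h1, ← Matrix.transpose_mul, h2, Matrix.transpose_one]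

/-- **`SU(4)` preserves `V`**: for `A ∈ SU(4)`, `A X(v) Aᵀ = X(coord (A X(v) Aᵀ))` (it is
antisymmetric, `Y Yᴴ = ⟪v, v⟫ · 1` by unitarity, `pf Y = det A · pf X(v) = ⟪v, v⟫`).
[cite: Porteous1995, Prop. 17.3] -/
theorem xMat_coord_conj {A : Matrix (Fin 4) (Fin 4) ℂ} (hA : A ∈ Matrix.specialUnitaryGroup (Fin 4) ℂ)
    (v : Fin 6 → ℝ) : xMat (coord (A * xMat v * Aᵀ)) = A * xMat v * Aᵀ := by
  rw [Matrix.mem_specialUnitaryGroup_iff] at hA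
  refine xMat_coord_of_mul_conjTranspose (r := v ⬝ᵥ v) ?_ ?_ ?_
  · rw [xMat]; exact transpose_conj_antisym A _
  · rw [Matrix.conjTranspose_mul, Matrix.conjTranspose_mul]
    have h1 : A * xMat v * Aᵀ * ((Aᵀ)ᴴ * ((xMat v)ᴴ * Aᴴ)) =
        A * (xMat v * (Aᵀ * (Aᵀ)ᴴ) * (xMat v)ᴴ) * Aᴴ := by
      simp only [Matrix.mul_assoc]
    rw [h1, transpose_mul_conjTranspose_transpose hA.1, Matrix.mul_one, xMat_mul_conjTranspose_self,
      Matrix.mul_smul, Matrix.mul_one, Matrix.smul_mul]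
    have h2 : A * Aᴴ = 1 := by
      have := Matrix.mem_unitaryGroup_iff.1 hA.1
      rwa [star_eq_conjTranspose] at this
    rw [h2]
  · rw [xMat, pf_conj, hA.2, one_mul, ← xMat, pf_xMat]

/-- **The matrix of `A ∈ SU(4)` acting on `V ≅ ℝ⁶`**: column `j` is `coord (A X(eⱼ) Aᵀ)`.
[cite: Porteous1995, Prop. 17.3] -/
def toO6 (A : Matrix (Fin 4) (Fin 4) ℂ) : Matrix (Fin 6) (Fin 6) ℝ :=
  Matrix.of fun i j => coord (A * xMat (Pi.single j 1) * Aᵀ) i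

/-- `toO6 A *ᵥ v = coord (A X(v) Aᵀ)` (linearity). [folklore] -/
theorem toO6_mulVec (A : Matrix (Fin 4) (Fin 4) ℂ) (v : Fin 6 → ℝ) :
    toO6 A *ᵥ v = coord (A * xMat v * Aᵀ) := by
  rw [xMat_eq_sum_single, Finset.mul_sum, Finset.sum_mul, coord_sum]
  ext i
  simp only [Matrix.mulVec, dotProduct, toO6, Matrix.of_apply, Finset.sum_apply]
  refine Finset.sum_congr rfl fun j _ => ?_
  rw [Matrix.mul_smul, Matrix.smul_mul, coord_smul, Pi.smul_apply, smul_eq_mul, mul_comm]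

/-- **`X(toO6 A · v) = A X(v) Aᵀ`** for `A ∈ SU(4)`. [cite: Porteous1995, Prop. 17.3] -/
theorem xMat_toO6_mulVec {A : Matrix (Fin 4) (Fin 4) ℂ} (hA : A ∈ Matrix.specialUnitaryGroup (Fin 4) ℂ)
    (v : Fin 6 → ℝ) : xMat (toO6 A *ᵥ v) = A * xMat v * Aᵀ := by
  rw [toO6_mulVec, xMat_coord_conj hA]

/-- Two real matrices with the same action on vectors are equal. [folklore] -/
theorem eq_of_mulVec_eq {N : ℕ} {M M' : Matrix (Fin N) (Fin N) ℝ} (h : ∀ v, M *ᵥ v = M' *ᵥ v) : M = M' := by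
  ext i j
  have := congrFun (h (Pi.single j 1)) i
  simpa [Matrix.mulVec_single_one] using this

/-- `toO6 1 = 1`. [folklore] -/
theorem toO6_one : toO6 (1 : Matrix (Fin 4) (Fin 4) ℂ) = 1 := by
  refine eq_of_mulVec_eq fun v => ?_
  rw [toO6_mulVec, Matrix.one_mul, Matrix.transpose_one, Matrix.mul_one, coord_xMat, Matrix.one_mulVec]

/-- **`toO6` is multiplicative** (`B ∈ SU(4)`, `A` arbitrary). [folklore] -/
theorem toO6_mul (A : Matrix (Fin 4) (Fin 4) ℂ) {B : Matrix (Fin 4) (Fin 4) ℂ}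
    (hB : B ∈ Matrix.specialUnitaryGroup (Fin 4) ℂ) : toO6 (A * B) = toO6 A * toO6 B := by
  refine eq_of_mulVec_eq fun v => ?_
  rw [← Matrix.mulVec_mulVec, toO6_mulVec, toO6_mulVec, xMat_toO6_mulVec hB, Matrix.transpose_mul]
  simp only [Matrix.mul_assoc]

/-- **`toO6 A` is an isometry**: `⟪toO6 A · v, toO6 A · v⟫ = ⟪v, v⟫` (`pf` of both sides of
`X(toO6 A · v) = A X(v) Aᵀ`). [folklore] -/
theorem dotProduct_toO6_mulVec_self {A : Matrix (Fin 4) (Fin 4) ℂ} (hA : A ∈ Matrix.specialUnitaryGroup (Fin 4) ℂ)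
    (v : Fin 6 → ℝ) : (toO6 A *ᵥ v) ⬝ᵥ (toO6 A *ᵥ v) = v ⬝ᵥ v := by
  have h := congrArg pf (xMat_toO6_mulVec hA v)
  rw [pf_xMat, xMat, pf_conj, (Matrix.mem_specialUnitaryGroup_iff.1 hA).2, one_mul, ← xMat, pf_xMat] at h
  exact_mod_cast h

/-- `toO6 A` preserves inner products (polarisation). [folklore] -/
theorem dotProduct_toO6_mulVec {A : Matrix (Fin 4) (Fin 4) ℂ} (hA : A ∈ Matrix.specialUnitaryGroup (Fin 4) ℂ)
    (v w : Fin 6 → ℝ) : (toO6 A *ᵥ v) ⬝ᵥ (toO6 A *ᵥ w) = v ⬝ᵥ w := by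
  have h1 := dotProduct_toO6_mulVec_self hA (v + w)
  have h2 := dotProduct_toO6_mulVec_self hA v
  have h3 := dotProduct_toO6_mulVec_self hA w
  rw [Matrix.mulVec_add] at h1
  simp only [add_dotProduct, dotProduct_add] at h1
  rw [dotProduct_comm (toO6 A *ᵥ w) (toO6 A *ᵥ v), dotProduct_comm w v] at h1
  linarith

/-- **`toO6 A ∈ O(6)`** for `A ∈ SU(4)`. [cite: Porteous1995, Prop. 17.3] -/
theorem toO6_mem_orthogonalGroup {A : Matrix (Fin 4) (Fin 4) ℂ} (hA : A ∈ Matrix.specialUnitaryGroup (Fin 4) ℂ) :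
    toO6 A ∈ Matrix.orthogonalGroup (Fin 6) ℝ := by
  rw [Matrix.mem_orthogonalGroup_iff']
  ext i j
  have h := dotProduct_toO6_mulVec hA (Pi.single i 1) (Pi.single j 1)
  simp only [Matrix.mulVec_single_one] at h
  have lhs : ((toO6 A)ᵀ * toO6 A) i j = (toO6 A).col i ⬝ᵥ (toO6 A).col j := by
    simp [Matrix.mul_apply, dotProduct]
  rw [lhs, h, single_dotProduct, one_mul, Pi.single_apply, Matrix.one_apply, eq_comm]

/-- `A ↦ toO6 A` is continuous (its entries are polynomials in the entries of `A` and `Ā`). [folklore] -/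
theorem continuous_toO6 : Continuous (toO6 : Matrix (Fin 4) (Fin 4) ℂ → Matrix (Fin 6) (Fin 6) ℝ) := by
  refine continuous_matrix fun i j => ?_
  have hc : ∀ k l : Fin 4, Continuous fun A : Matrix (Fin 4) (Fin 4) ℂ => (A * xMat (Pi.single j 1) * Aᵀ) k l :=
    fun k l => ((continuous_id.matrix_mul continuous_const).matrix_mul continuous_id.matrix_transpose).matrix_elem k l
  simp only [toO6, Matrix.of_apply]
  fin_cases i
  · exact Complex.continuous_re.comp (hc 0 1)
  · exact Complex.continuous_im.comp (hc 0 1)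
  · exact Complex.continuous_re.comp (hc 0 2)
  · exact Complex.continuous_im.comp (hc 0 2)
  · exact Complex.continuous_re.comp (hc 0 3)
  · exact Complex.continuous_im.comp (hc 0 3)

end Action

/-! ### 4. The kernel of `toO6` is `{±1}` -/

section Kernel

/-- `2 F₀₁ = X(e₀) - i X(e₁)` (the elementary antisymmetric matrices are complex combinations of
the `X(eⱼ)`). [folklore] -/
theorem two_smul_antisym_single_0 : (2 : ℂ) • antisym (Pi.single 0 1 : Fin 6 → ℂ) =
    xMat (Pi.single 0 1) - I • xMat (Pi.single 1 1) := by
  ext i j; fin_cases i <;> fin_cases j <;> simp [xMat, xVec, za, zb, zc, antisym] <;> ring_nf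

/-- `2 F₂₃ = X(e₀) + i X(e₁)`. [folklore] -/
theorem two_smul_antisym_single_5 : (2 : ℂ) • antisym (Pi.single 5 1 : Fin 6 → ℂ) =
    xMat (Pi.single 0 1) + I • xMat (Pi.single 1 1) := by
  ext i j; fin_cases i <;> fin_cases j <;> simp [xMat, xVec, za, zb, zc, antisym] <;> ring_nf

/-- `2 F₀₂ = X(e₂) - i X(e₃)`. [folklore] -/
theorem two_smul_antisym_single_1 : (2 : ℂ) • antisym (Pi.single 1 1 : Fin 6 → ℂ) =
    xMat (Pi.single 2 1) - I • xMat (Pi.single 3 1) := by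
  ext i j; fin_cases i <;> fin_cases j <;> simp [xMat, xVec, za, zb, zc, antisym] <;> ring_nf

/-- `-2 F₁₃ = X(e₂) + i X(e₃)`. [folklore] -/
theorem two_smul_antisym_single_4 : (-2 : ℂ) • antisym (Pi.single 4 1 : Fin 6 → ℂ) =
    xMat (Pi.single 2 1) + I • xMat (Pi.single 3 1) := by
  ext i j; fin_cases i <;> fin_cases j <;> simp [xMat, xVec, za, zb, zc, antisym] <;> ring_nf

/-- `2 F₀₃ = X(e₄) - i X(e₅)`. [folklore] -/
theorem two_smul_antisym_single_2 : (2 : ℂ) • antisym (Pi.single 2 1 : Fin 6 → ℂ) =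
    xMat (Pi.single 4 1) - I • xMat (Pi.single 5 1) := by
  ext i j; fin_cases i <;> fin_cases j <;> simp [xMat, xVec, za, zb, zc, antisym] <;> ring_nf

variable {A : Matrix (Fin 4) (Fin 4) ℂ}

/-- If `A ∈ SU(4)` acts trivially on `V` then `A X(v) = X(v) Ā` (`Ā = (Aᵀ)ᴴ`, using `Aᵀ Ā = 1`). [folklore] -/
theorem mul_xMat_eq_of_toO6_eq_one (hA : A ∈ Matrix.specialUnitaryGroup (Fin 4) ℂ) (h1 : toO6 A = 1)
    (v : Fin 6 → ℝ) : A * xMat v = xMat v * (Aᵀ)ᴴ := by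
  have h := xMat_toO6_mulVec hA v
  rw [h1, Matrix.one_mulVec] at h
  calc A * xMat v = A * xMat v * (Aᵀ * (Aᵀ)ᴴ) := by
        rw [transpose_mul_conjTranspose_transpose (Matrix.mem_specialUnitaryGroup_iff.1 hA).1, Matrix.mul_one]
    _ = (A * xMat v * Aᵀ) * (Aᵀ)ᴴ := by simp only [Matrix.mul_assoc]
    _ = xMat v * (Aᵀ)ᴴ := by rw [← h]

/-- Combination step: if `c F = X(e_p) + s X(e_q)` with `c ≠ 0` then `A F = F Ā`. [folklore] -/
theorem mul_eq_mul_of_combination (hA : A ∈ Matrix.specialUnitaryGroup (Fin 4) ℂ) (h1 : toO6 A = 1)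
    {c s : ℂ} {p q : Fin 6} {F : Matrix (Fin 4) (Fin 4) ℂ} (hc : c ≠ 0)
    (hF : c • F = xMat (Pi.single p 1) + s • xMat (Pi.single q 1)) : A * F = F * (Aᵀ)ᴴ := by
  have E := mul_xMat_eq_of_toO6_eq_one hA h1
  have h2 : A * (c • F) = (c • F) * (Aᵀ)ᴴ := by
    rw [hF, Matrix.mul_add, Matrix.add_mul, Matrix.mul_smul, Matrix.smul_mul, E (Pi.single p 1),
      E (Pi.single q 1)]
  rw [Matrix.mul_smul, Matrix.smul_mul] at h2
  exact smul_right_injective _ hc h2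

/-- `A F₀₁ = F₀₁ Ā`. [folklore] -/
theorem mul_antisym_single_0 (hA : A ∈ Matrix.specialUnitaryGroup (Fin 4) ℂ) (h1 : toO6 A = 1) :
    A * antisym (Pi.single 0 1 : Fin 6 → ℂ) = antisym (Pi.single 0 1 : Fin 6 → ℂ) * (Aᵀ)ᴴ :=
  mul_eq_mul_of_combination hA h1 (s := -I) two_ne_zero (by rw [two_smul_antisym_single_0, neg_smul, sub_eq_add_neg])

/-- `A F₀₂ = F₀₂ Ā`. [folklore] -/
theorem mul_antisym_single_1 (hA : A ∈ Matrix.specialUnitaryGroup (Fin 4) ℂ) (h1 : toO6 A = 1) :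
    A * antisym (Pi.single 1 1 : Fin 6 → ℂ) = antisym (Pi.single 1 1 : Fin 6 → ℂ) * (Aᵀ)ᴴ :=
  mul_eq_mul_of_combination hA h1 (s := -I) two_ne_zero (by rw [two_smul_antisym_single_1, neg_smul, sub_eq_add_neg])

/-- `A F₀₃ = F₀₃ Ā`. [folklore] -/
theorem mul_antisym_single_2 (hA : A ∈ Matrix.specialUnitaryGroup (Fin 4) ℂ) (h1 : toO6 A = 1) :
    A * antisym (Pi.single 2 1 : Fin 6 → ℂ) = antisym (Pi.single 2 1 : Fin 6 → ℂ) * (Aᵀ)ᴴ :=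
  mul_eq_mul_of_combination hA h1 (s := -I) two_ne_zero (by rw [two_smul_antisym_single_2, neg_smul, sub_eq_add_neg])

/-- `A F₁₃ = F₁₃ Ā`. [folklore] -/
theorem mul_antisym_single_4 (hA : A ∈ Matrix.specialUnitaryGroup (Fin 4) ℂ) (h1 : toO6 A = 1) :
    A * antisym (Pi.single 4 1 : Fin 6 → ℂ) = antisym (Pi.single 4 1 : Fin 6 → ℂ) * (Aᵀ)ᴴ :=
  mul_eq_mul_of_combination hA h1 (s := I) (c := -2) (by norm_num) (by rw [two_smul_antisym_single_4])

/-- `A F₂₃ = F₂₃ Ā`. [folklore] -/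
theorem mul_antisym_single_5 (hA : A ∈ Matrix.specialUnitaryGroup (Fin 4) ℂ) (h1 : toO6 A = 1) :
    A * antisym (Pi.single 5 1 : Fin 6 → ℂ) = antisym (Pi.single 5 1 : Fin 6 → ℂ) * (Aᵀ)ᴴ :=
  mul_eq_mul_of_combination hA h1 (s := I) two_ne_zero (by rw [two_smul_antisym_single_5])

/-- **The kernel of `SU(4) → O(6)` is `{±1}`**: if `A ∈ SU(4)` acts trivially on `V` then `A = ±1`
(from `A F = F Ā` for the elementary antisymmetric `F`: `A` is diagonal with equal real entries,
and `det A = 1`). [cite: Porteous1995, Prop. 17.3] -/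
theorem eq_one_or_eq_neg_one_of_toO6_eq_one (hA : A ∈ Matrix.specialUnitaryGroup (Fin 4) ℂ) (h1 : toO6 A = 1) :
    A = 1 ∨ A = -1 := by
  have F0 := fun k l => congrFun (congrFun (mul_antisym_single_0 hA h1) k) l
  have F1 := fun k l => congrFun (congrFun (mul_antisym_single_1 hA h1) k) l
  have F2 := fun k l => congrFun (congrFun (mul_antisym_single_2 hA h1) k) l
  have F4 := fun k l => congrFun (congrFun (mul_antisym_single_4 hA h1) k) l
  have F5 := fun k l => congrFun (congrFun (mul_antisym_single_5 hA h1) k) l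
  -- off-diagonal entries vanish
  have h20 : A 2 0 = 0 := by simpa [Matrix.mul_apply, Fin.sum_univ_four, antisym] using F0 2 1
  have h30 : A 3 0 = 0 := by simpa [Matrix.mul_apply, Fin.sum_univ_four, antisym] using F0 3 1
  have h21 : A 2 1 = 0 := by simpa [Matrix.mul_apply, Fin.sum_univ_four, antisym] using F0 2 0
  have h31 : A 3 1 = 0 := by simpa [Matrix.mul_apply, Fin.sum_univ_four, antisym] using F0 3 0
  have h02 : A 0 2 = 0 := by simpa [Matrix.mul_apply, Fin.sum_univ_four, antisym] using F5 0 3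
  have h12 : A 1 2 = 0 := by simpa [Matrix.mul_apply, Fin.sum_univ_four, antisym] using F5 1 3
  have h03 : A 0 3 = 0 := by simpa [Matrix.mul_apply, Fin.sum_univ_four, antisym] using F5 0 2
  have h13 : A 1 3 = 0 := by simpa [Matrix.mul_apply, Fin.sum_univ_four, antisym] using F5 1 2
  have h10 : A 1 0 = 0 := by simpa [Matrix.mul_apply, Fin.sum_univ_four, antisym] using F1 1 2
  have h32 : A 3 2 = 0 := by simpa [Matrix.mul_apply, Fin.sum_univ_four, antisym] using F1 3 0
  have h01 : A 0 1 = 0 := by simpa [Matrix.mul_apply, Fin.sum_univ_four, antisym] using F4 0 3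
  have h23 : A 2 3 = 0 := by simpa [Matrix.mul_apply, Fin.sum_univ_four, antisym] using F4 2 1
  -- diagonal entries
  have d01 : A 0 0 = conj (A 1 1) := by simpa [Matrix.mul_apply, Fin.sum_univ_four, antisym] using F0 0 1
  have d23 : A 2 2 = conj (A 3 3) := by simpa [Matrix.mul_apply, Fin.sum_univ_four, antisym] using F5 2 3
  have d02 : A 0 0 = conj (A 2 2) := by simpa [Matrix.mul_apply, Fin.sum_univ_four, antisym] using F1 0 2
  have d03 : A 0 0 = conj (A 3 3) := by simpa [Matrix.mul_apply, Fin.sum_univ_four, antisym] using F2 0 3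
  generalize ht : A 0 0 = t at d01 d02 d03
  have e11 : A 1 1 = conj t := by rw [d01, Complex.conj_conj]
  have e22 : A 2 2 = conj t := by rw [d02, Complex.conj_conj]
  have e33 : A 3 3 = conj t := by rw [d03, Complex.conj_conj]
  have treal : conj t = t := by
    have := d23; rw [e22, e33, Complex.conj_conj] at this; exact this
  have hAt : A = t • (1 : Matrix (Fin 4) (Fin 4) ℂ) := by
    ext i j
    fin_cases i <;> fin_cases j <;>
      simp [h01, h02, h03, h10, h12, h13, h20, h21, h23, h30, h31, h32, e11, e22, e33, treal, ht]
  have hdet := (Matrix.mem_specialUnitaryGroup_iff.1 hA).2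
  rw [hAt, Matrix.det_smul, Matrix.det_one, mul_one, Fintype.card_fin] at hdet
  -- `t` is real with `t⁴ = 1`, so `t = ±1`
  obtain ⟨r, hr⟩ : ∃ r : ℝ, (r : ℂ) = t := ⟨t.re, Complex.conj_eq_iff_re.1 treal⟩
  rw [← hr] at hdet
  have hr4 : r ^ 4 = 1 := by exact_mod_cast hdet
  have hr2 : r ^ 2 = 1 := by nlinarith [sq_nonneg r, sq_nonneg (r ^ 2 + 1)]
  have hr1 : r = 1 ∨ r = -1 := mul_self_eq_one_iff.1 (show r * r = 1 by rw [← sq]; exact hr2)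
  rcases hr1 with h | h
  · left; rw [hAt, ← hr, h]; simp
  · right; rw [hAt, ← hr, h]; simp

end Kernel

/-! ### 5. Reflections; `SO(N)` is generated by products of two reflections; the image of `toO6` -/

section Reflections

/-- **`X(ρᵤ x) = -X(u) X(x)ᴴ X(u)`** for a unit vector `u` (`ρᵤ` the Householder reflection): the
Clifford-algebra formula `ρᵤ(x) = -u x u` in the model `V`. [cite: Porteous1995, Prop. 17.3] -/
theorem xMat_reflMat_mulVec {u : Fin 6 → ℝ} (hu : u ⬝ᵥ u = 1) (x : Fin 6 → ℝ) :
    xMat (reflMat u *ᵥ x) = -(xMat u * (xMat x)ᴴ * xMat u) := by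
  rw [reflMat_mulVec, hu, div_one, xMat_sub, xMat_smul]
  have h1 : xMat u * (xMat x)ᴴ = ((2 * (u ⬝ᵥ x) : ℝ) : ℂ) • (1 : Matrix (Fin 4) (Fin 4) ℂ) - xMat x * (xMat u)ᴴ :=
    eq_sub_of_add_eq (xMat_mul_conjTranspose_add u x)
  rw [h1, Matrix.sub_mul, Matrix.smul_mul, Matrix.one_mul, Matrix.mul_assoc, conjTranspose_mul_xMat_self, hu,
    Complex.ofReal_one, one_smul, Matrix.mul_one, neg_sub]

/-- The preimage `B(u, w) = X(u) X(w)ᴴ` of the rotation `ρᵤ ρ_w`. [folklore] -/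
def bMat (u w : Fin 6 → ℝ) : Matrix (Fin 4) (Fin 4) ℂ := xMat u * (xMat w)ᴴ

/-- `B(u, w) ∈ SU(4)` for unit vectors `u, w`. [folklore] -/
theorem bMat_mem {u w : Fin 6 → ℝ} (hu : u ⬝ᵥ u = 1) (hw : w ⬝ᵥ w = 1) :
    bMat u w ∈ Matrix.specialUnitaryGroup (Fin 4) ℂ := by
  rw [Matrix.mem_specialUnitaryGroup_iff]
  refine ⟨?_, ?_⟩
  · rw [Matrix.mem_unitaryGroup_iff, star_eq_conjTranspose, bMat, Matrix.conjTranspose_mul,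
      Matrix.conjTranspose_conjTranspose, Matrix.mul_assoc, ← Matrix.mul_assoc (xMat w)ᴴ,
      conjTranspose_mul_xMat_self, hw, Complex.ofReal_one, one_smul, Matrix.one_mul,
      xMat_mul_conjTranspose_self, hu, Complex.ofReal_one, one_smul]
  · rw [bMat, Matrix.det_mul, Matrix.det_conjTranspose, det_xMat, det_xMat, hu, hw]
    simp

/-- `B(u, w)ᵀ = X(w)ᴴ X(u)`. [folklore] -/
theorem transpose_bMat (u w : Fin 6 → ℝ) : (bMat u w)ᵀ = (xMat w)ᴴ * xMat u := by
  rw [bMat, Matrix.transpose_mul, transpose_xMat]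
  have h1 : ((xMat w)ᴴ)ᵀ = -(xMat w)ᴴ := by
    ext i j; fin_cases i <;> fin_cases j <;> simp [xMat, antisym, Matrix.conjTranspose_apply]
  rw [h1, neg_mul_neg]

/-- **`B(u, w) X(x) B(u, w)ᵀ = X(ρᵤ ρ_w x)`** for unit `u, w`. [cite: Porteous1995, Prop. 17.3] -/
theorem bMat_conj_xMat {u w : Fin 6 → ℝ} (hu : u ⬝ᵥ u = 1) (hw : w ⬝ᵥ w = 1) (x : Fin 6 → ℝ) :
    bMat u w * xMat x * (bMat u w)ᵀ = xMat (reflMat u *ᵥ (reflMat w *ᵥ x)) := by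
  rw [xMat_reflMat_mulVec hu, xMat_reflMat_mulVec hw, transpose_bMat, bMat]
  simp only [Matrix.conjTranspose_neg, Matrix.conjTranspose_mul, Matrix.conjTranspose_conjTranspose,
    Matrix.mul_neg, Matrix.neg_mul, neg_neg, Matrix.mul_assoc]

/-- **`toO6 (B(u, w)) = ρᵤ ρ_w`**: every product of two reflections of `ℝ⁶` is in the image of
`SU(4)`. [cite: Porteous1995, Prop. 17.3] -/
theorem toO6_bMat {u w : Fin 6 → ℝ} (hu : u ⬝ᵥ u = 1) (hw : w ⬝ᵥ w = 1) :
    toO6 (bMat u w) = reflMat u * reflMat w := by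
  refine eq_of_mulVec_eq fun x => ?_
  have h := congrArg coord (xMat_toO6_mulVec (bMat_mem hu hw) x)
  rw [bMat_conj_xMat hu hw, coord_xMat, coord_xMat] at h
  rw [h, Matrix.mulVec_mulVec]

end Reflections

section Generation

variable {N : ℕ}

/-- The set of products `ρᵤ ρ_w` of two Householder reflections in non-zero vectors of `ℝᴺ`. [folklore] -/
def reflPair (N : ℕ) : Set (Matrix (Fin N) (Fin N) ℝ) :=
  {M | ∃ u w : Fin N → ℝ, u ⬝ᵥ u ≠ 0 ∧ w ⬝ᵥ w ≠ 0 ∧ M = reflMat u * reflMat w}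

/-- `1 ⊕ ρᵤ = ρ_{(0, u)}`. [folklore] -/
theorem blockSucc_reflMat (u : Fin N → ℝ) : blockSucc (reflMat u) = reflMat (Fin.cons 0 u : Fin (N + 1) → ℝ) := by
  have hd : (Fin.cons 0 u : Fin (N + 1) → ℝ) ⬝ᵥ (Fin.cons 0 u : Fin (N + 1) → ℝ) = u ⬝ᵥ u := by
    simp [dotProduct, Fin.sum_univ_succ]
  ext i j
  refine Fin.cases ?_ (fun i' => ?_) i <;> refine Fin.cases ?_ (fun j' => ?_) j
  · rw [blockSucc_zero_zero]; simp [reflMat, Matrix.sub_apply, vecMulVec_apply]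
  · rw [blockSucc_zero_succ]; simp [reflMat, Matrix.sub_apply, vecMulVec_apply, (Fin.succ_ne_zero j').symm]
  · rw [blockSucc_succ_zero]; simp [reflMat, Matrix.sub_apply, vecMulVec_apply, Fin.succ_ne_zero]
  · rw [blockSucc_succ_succ]; simp [reflMat, Matrix.sub_apply, vecMulVec_apply, hd, Matrix.one_apply]

/-- `A ↦ 1 ⊕ A` as a monoid homomorphism. [folklore] -/
def blockSuccHom (N : ℕ) : Matrix (Fin N) (Fin N) ℝ →* Matrix (Fin (N + 1)) (Fin (N + 1)) ℝ where
  toFun := blockSucc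
  map_one' := blockSucc_one
  map_mul' := blockSucc_mul

/-- `1 ⊕ ·` maps the submonoid generated by reflection pairs into the next one. [folklore] -/
theorem blockSucc_mem_closure_reflPair {M : Matrix (Fin N) (Fin N) ℝ} (hM : M ∈ Submonoid.closure (reflPair N)) :
    blockSucc M ∈ Submonoid.closure (reflPair (N + 1)) := by
  have h1 : (Submonoid.closure (reflPair N)).map (blockSuccHom N) ≤ Submonoid.closure (reflPair (N + 1)) := by
    rw [MonoidHom.map_mclosure]
    refine Submonoid.closure_mono ?_
    rintro _ ⟨M, ⟨u, w, hu, hw, rfl⟩, rfl⟩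
    refine ⟨Fin.cons 0 u, Fin.cons 0 w, by simpa [dotProduct, Fin.sum_univ_succ] using hu,
      by simpa [dotProduct, Fin.sum_univ_succ] using hw, ?_⟩
    change blockSucc (reflMat u * reflMat w) = _
    rw [blockSucc_mul, blockSucc_reflMat, blockSucc_reflMat]
  exact h1 ⟨M, hM, rfl⟩

/-- An orthogonal matrix `R` satisfies `R Rᵀ = 1`. [folklore] -/
theorem mul_transpose_of_mem_orthogonalGroup {R : Matrix (Fin N) (Fin N) ℝ}
    (hR : R ∈ Matrix.orthogonalGroup (Fin N) ℝ) : R * Rᵀ = 1 := by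
  simpa using (Matrix.mem_orthogonalGroup_iff (Fin N) ℝ).1 hR

/-- An orthogonal matrix `R` satisfies `Rᵀ R = 1`. [folklore] -/
theorem transpose_mul_of_mem_orthogonalGroup {R : Matrix (Fin N) (Fin N) ℝ}
    (hR : R ∈ Matrix.orthogonalGroup (Fin N) ℝ) : Rᵀ * R = 1 := by
  simpa using (Matrix.mem_orthogonalGroup_iff' (Fin N) ℝ).1 hR

/-- The transpose of a special orthogonal matrix is special orthogonal. [folklore] -/
theorem transpose_mem_specialOrthogonalGroup {R : Matrix (Fin N) (Fin N) ℝ}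
    (hR : R ∈ Matrix.specialOrthogonalGroup (Fin N) ℝ) : Rᵀ ∈ Matrix.specialOrthogonalGroup (Fin N) ℝ := by
  rw [Matrix.mem_specialOrthogonalGroup_iff] at hR ⊢
  refine ⟨?_, by rw [Matrix.det_transpose, hR.2]⟩
  rw [Matrix.mem_orthogonalGroup_iff]
  simpa using transpose_mul_of_mem_orthogonalGroup hR.1

/-- The reduction step: if `R` is in the submonoid generated by reflection pairs, lies in
`SO(N + 1)` and moves `e₀` to the first column of `g ∈ SO(N + 1)`, and `SO(N)` is generated by
reflection pairs, then `g` is in the submonoid (`Rᵀ g` fixes `e₀`, hence is `1 ⊕ h'` with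
`h' ∈ SO(N)`). [folklore] -/
theorem mem_closure_reflPair_of_rot {g R : Matrix (Fin (N + 1)) (Fin (N + 1)) ℝ}
    (ih : ∀ h : Matrix (Fin N) (Fin N) ℝ, h ∈ Matrix.specialOrthogonalGroup (Fin N) ℝ → h ∈ Submonoid.closure (reflPair N))
    (hg : g ∈ Matrix.specialOrthogonalGroup (Fin (N + 1)) ℝ) (hRc : R ∈ Submonoid.closure (reflPair (N + 1)))
    (hRS : R ∈ Matrix.specialOrthogonalGroup (Fin (N + 1)) ℝ) (hRb : R *ᵥ Pi.single 0 1 = fun i => g i 0) :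
    g ∈ Submonoid.closure (reflPair (N + 1)) := by
  have hRO := (Matrix.mem_specialOrthogonalGroup_iff.1 hRS).1
  have hRRt := mul_transpose_of_mem_orthogonalGroup hRO
  have hRtR := transpose_mul_of_mem_orthogonalGroup hRO
  set h := Rᵀ * g with hh
  have hhS : h ∈ Matrix.specialOrthogonalGroup (Fin (N + 1)) ℝ :=
    Submonoid.mul_mem _ (transpose_mem_specialOrthogonalGroup hRS) hg
  have hcol : Rᵀ *ᵥ (fun i => g i 0) = Pi.single 0 1 := by
    rw [← hRb, Matrix.mulVec_mulVec, hRtR, Matrix.one_mulVec]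
  have h0 : ∀ i, h i 0 = (1 : Matrix (Fin (N + 1)) (Fin (N + 1)) ℝ) i 0 := fun i => by
    have := congrFun hcol i
    simp only [Matrix.mulVec, dotProduct, Matrix.transpose_apply] at this
    rw [hh, Matrix.mul_apply]
    simp only [Matrix.transpose_apply]
    rw [this, Matrix.one_apply, Pi.single_apply]
  have hO := (Matrix.mem_specialOrthogonalGroup_iff.1 hhS).1
  have heq : h = blockSucc (h.submatrix Fin.succ Fin.succ) := eq_blockSucc_submatrix hO h0
  have hsub := submatrix_mem_specialOrthogonalGroup hhS h0
  have hhc : h ∈ Submonoid.closure (reflPair (N + 1)) := by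
    rw [heq]; exact blockSucc_mem_closure_reflPair (ih _ hsub)
  have hg' : g = R * h := by rw [hh, ← Matrix.mul_assoc, hRRt, Matrix.one_mul]
  rw [hg']
  exact Submonoid.mul_mem _ hRc hhc

/-- `rotMat a b` is a reflection pair. [folklore] -/
theorem rotMat_mem_reflPair {a b : Fin N → ℝ} (hb : b ⬝ᵥ b ≠ 0) (hs : (a + b) ⬝ᵥ (a + b) ≠ 0) :
    rotMat a b ∈ reflPair N := ⟨b, a + b, hb, hs, rfl⟩

/-- **`SO(N)` is generated, as a monoid, by products of two reflections** (weak Cartan–Dieudonné: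
move the first column back to `e₀` by one or two rotations `R(a, b) = ρ_b ρ_{a+b}` and induct on
the stabiliser `1 ⊕ SO(N - 1)`). [folklore] -/
theorem mem_closure_reflPair_of_mem_specialOrthogonalGroup :
    ∀ (N : ℕ) (g : Matrix (Fin N) (Fin N) ℝ), g ∈ Matrix.specialOrthogonalGroup (Fin N) ℝ →
      g ∈ Submonoid.closure (reflPair N)
  | 0, g, _ => by rw [Subsingleton.elim g 1]; exact Submonoid.one_mem _
  | N + 1, g, hg => by
    set b : Fin (N + 1) → ℝ := fun i => g i 0 with hb
    set e₀ : Fin (N + 1) → ℝ := Pi.single 0 1 with he₀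
    have hgO := (Matrix.mem_specialOrthogonalGroup_iff.1 hg).1
    have hbb : b ⬝ᵥ b = 1 := by
      have := congrFun (congrFun (transpose_mul_of_mem_orthogonalGroup hgO) 0) 0
      simpa [Matrix.mul_apply, dotProduct] using this
    have he₀e₀ : e₀ ⬝ᵥ e₀ = 1 := by simp [he₀]
    have ih := mem_closure_reflPair_of_mem_specialOrthogonalGroup N
    by_cases hs : (e₀ + b) ⬝ᵥ (e₀ + b) = 0
    · -- `b = -e₀`; impossible for `N = 0`, two rotations for `N ≥ 1`
      have hbe : b = -e₀ := eq_neg_of_add_eq_zero_right (dotProduct_self_eq_zero.1 hs)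
      cases N with
      | zero =>
        exfalso
        have hdet := (Matrix.mem_specialOrthogonalGroup_iff.1 hg).2
        rw [Matrix.det_fin_one] at hdet
        have : g 0 0 = -1 := by
          have := congrFun hbe 0
          simpa [hb, he₀] using this
        rw [this] at hdet
        norm_num at hdet
      | succ N =>
        set e₁ : Fin (N + 1 + 1) → ℝ := Pi.single 1 1 with he₁
        have h10 : (1 : Fin (N + 1 + 1)) ≠ 0 := by simp
        have he₁e₁ : e₁ ⬝ᵥ e₁ = 1 := by simp [he₁]
        have he₀e₁ : e₀ ⬝ᵥ e₁ = 0 := by simp [he₀, he₁]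
        have hs1 : (e₀ + e₁) ⬝ᵥ (e₀ + e₁) ≠ 0 := by
          simp only [add_dotProduct, dotProduct_add, he₀e₀, he₁e₁, he₀e₁, dotProduct_comm e₁ e₀]
          norm_num
        have hne : (-e₀) ⬝ᵥ (-e₀) ≠ 0 := by simp [he₀e₀]
        have hs2 : (e₁ + -e₀) ⬝ᵥ (e₁ + -e₀) ≠ 0 := by
          simp only [add_dotProduct, dotProduct_add, neg_dotProduct, dotProduct_neg, he₀e₀, he₁e₁, he₀e₁,
            dotProduct_comm e₁ e₀]
          norm_num
        refine mem_closure_reflPair_of_rot ih hg (R := rotMat e₁ (-e₀) * rotMat e₀ e₁)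
          (Submonoid.mul_mem _ (Submonoid.subset_closure (rotMat_mem_reflPair hne hs2))
            (Submonoid.subset_closure (rotMat_mem_reflPair (by rw [he₁e₁]; exact one_ne_zero) hs1)))
          (Submonoid.mul_mem _ (rotMat_mem_specialOrthogonalGroup hne hs2)
            (rotMat_mem_specialOrthogonalGroup (by rw [he₁e₁]; exact one_ne_zero) hs1)) ?_
        rw [← Matrix.mulVec_mulVec, rotMat_mulVec_left (by rw [he₀e₀, he₁e₁]) (by rw [he₁e₁]; exact one_ne_zero) hs1,
          rotMat_mulVec_left (by simp [he₀e₀, he₁e₁]) hne hs2, ← hbe]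
    · refine mem_closure_reflPair_of_rot ih hg (R := rotMat e₀ b)
        (Submonoid.subset_closure (rotMat_mem_reflPair (by rw [hbb]; exact one_ne_zero) hs))
        (rotMat_mem_specialOrthogonalGroup (by rw [hbb]; exact one_ne_zero) hs) ?_
      exact rotMat_mulVec_left (by rw [he₀e₀, hbb]) (by rw [hbb]; exact one_ne_zero) hs

/-- The self inner product of a real vector is non-negative. [folklore] -/
theorem dotProduct_self_nonneg' (u : Fin N → ℝ) : 0 ≤ u ⬝ᵥ u :=
  Finset.sum_nonneg fun i _ => mul_self_nonneg (u i)

/-- Normalising a non-zero vector does not change its reflection. [folklore] -/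
theorem exists_unit_reflMat_eq {u : Fin N → ℝ} (hu : u ⬝ᵥ u ≠ 0) :
    ∃ u' : Fin N → ℝ, u' ⬝ᵥ u' = 1 ∧ reflMat u' = reflMat u := by
  have hpos : 0 < u ⬝ᵥ u := lt_of_le_of_ne (dotProduct_self_nonneg' u) (Ne.symm hu)
  set c := (Real.sqrt (u ⬝ᵥ u))⁻¹ with hc
  have hc0 : c ≠ 0 := inv_ne_zero (Real.sqrt_pos.2 hpos).ne'
  refine ⟨c • u, ?_, reflMat_smul hc0⟩
  rw [smul_dotProduct, dotProduct_smul, smul_eq_mul, smul_eq_mul, ← mul_assoc, hc, ← mul_inv,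
    Real.mul_self_sqrt hpos.le, inv_mul_cancel₀ hu]

end Generation

/-- **The image of `SU(4) → O(6)` contains `SO(6)`**: every special orthogonal `6 × 6` matrix is
`toO6 A` for some `A ∈ SU(4)` (products of two reflections generate `SO(6)` and
`toO6 (X(u) X(w)ᴴ) = ρᵤ ρ_w`). [cite: Porteous1995, Prop. 17.3] -/
theorem exists_toO6_eq {g : Matrix (Fin 6) (Fin 6) ℝ} (hg : g ∈ Matrix.specialOrthogonalGroup (Fin 6) ℝ) :
    ∃ A ∈ Matrix.specialUnitaryGroup (Fin 4) ℂ, toO6 A = g := by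
  have hc := mem_closure_reflPair_of_mem_specialOrthogonalGroup 6 g hg
  refine Submonoid.closure_induction (fun M hM => ?_) ⟨1, Submonoid.one_mem _, toO6_one⟩
    (fun M M' _ _ h h' => ?_) hc
  · obtain ⟨u, w, hu, hw, rfl⟩ := hM
    obtain ⟨u', hu', hu'e⟩ := exists_unit_reflMat_eq hu
    obtain ⟨w', hw', hw'e⟩ := exists_unit_reflMat_eq hw
    exact ⟨bMat u' w', bMat_mem hu' hw', by rw [toO6_bMat hu' hw', hu'e, hw'e]⟩
  · obtain ⟨A, hA, rfl⟩ := h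
    obtain ⟨A', hA', rfl⟩ := h'
    exact ⟨A * A', Submonoid.mul_mem _ hA hA', toO6_mul A hA'⟩

/-- `-1 ∈ SU(4)` and `toO6 (-1) = 1`: the kernel has exactly two elements. [folklore] -/
theorem neg_one_mem_specialUnitaryGroup : (-1 : Matrix (Fin 4) (Fin 4) ℂ) ∈ Matrix.specialUnitaryGroup (Fin 4) ℂ := by
  rw [Matrix.mem_specialUnitaryGroup_iff, Matrix.mem_unitaryGroup_iff]
  refine ⟨by simp, ?_⟩
  rw [Matrix.det_neg, Matrix.det_one, Fintype.card_fin]; norm_num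

/-- `toO6 (-1) = 1`. [folklore] -/
theorem toO6_neg_one : toO6 (-1 : Matrix (Fin 4) (Fin 4) ℂ) = 1 := by
  refine eq_of_mulVec_eq fun v => ?_
  rw [toO6_mulVec, Matrix.transpose_neg, Matrix.transpose_one, Matrix.one_mulVec]
  simp

end SpinSix

end Literature.Topology.FourManifolds
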